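import Summits.HodgeConjecture.HodgeConjecture.Theorems.SignSymmetricPowersGeneralPencilEveryBase
import Literature.AlgebraicGeometry.HodgeTheory.GriffithsHolomorphicHodgeSubbundlesQPHolds
import HarnessLib

/-!
# Route `SignSymmetricPowers` — reading (a″)-B UNCONDITIONAL: on every good pencil of ι-even threefolds (even degree
# `d ≥ 4` in ℙ⁴) all but countably many members have the Hodge conjecture on all self-powers; every smooth ι-even
# threefold lies on such a pencil (Griffiths 1968 DISCHARGED by the cell's theorem `griffiths1968_holomorphicHodgeSubbundlesQP_holds`)

Support file for crux K1-B (stmt-HodgeConjecture-19716; `--supports … --as helper`; nothing here closes an item). Prover seat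
`hodge-nonav-prover-Ax` (g16). The tier-t3 hooks of programme PENCIL-B (g15, p695587 `signThreefoldPowersHodgeGeneralPencil_of_griffithsQP`,
p698672 `exists_goodPencil_through_of_griffithsQP`) took the quasi-projective form `Griffiths1968_holomorphicHodgeSubbundlesQP` of Griffiths'
holomorphy of the Hodge subbundles as their ONLY hypothesis; programme GRIFFITHS-HOLOMORPHY (prover-Bx g17–g18 with 19716-p2 and 20241-p1;
Voisin I Thm 10.9 via harmonic L²-stability and kernel frames) has PROVED it as
`Literature.AlgebraicGeometry.HodgeTheory.griffiths1968_holomorphicHodgeSubbundlesQP_holds` (p703278). One application each: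

* `signThreefoldPowersHodgeGeneralPencil_holds` — for every even `d ≥ 4` there is a non-zero polynomial `Q` on pairs of ι-even
  quinary coefficient vectors such that for all ι-even homogeneous `f₀, g` of degree `d` with `Q(f₀, g) ≠ 0`, all but COUNTABLY many
  members `X_u : f₀ + u·g = 0` of the pencil satisfy `HodgeConjectureFor (3(k+1)) Y` for every self fibre power `Y = X_u^{k+1}`.
* `exists_goodPencil_through_holds` — through EVERY smooth ι-even threefold `F₀ = 0` passes such a pencil (some ι-even direction
  `G`, countable exceptional set).

HONEST FRAMING: UNCONDITIONAL (axioms standard; no named fact, no hypothesis beyond the data); the exceptional sets are countable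
and unspecified (the member `u = 0` is not decided); this is reading (a″)-B, NOT items 19716 ∕ 19715 (reading (b), Cattani–Deligne–Kaplan
floor `hCDK`); rung F-H1 not moved by this file; nothing here says HC ∕ HC_CM ∕ HC_AV is proved.

## References
* [Griffiths1968PeriodsII] P. Griffiths, Periods of integrals on algebraic manifolds II, Amer. J. Math. 90 (1968), Thm. 1.1.
* [VoisinHodgeI2002] C. Voisin, *Hodge Theory and Complex Algebraic Geometry I*, §10.2.1 Thm. 10.3, Thm. 10.9.
* [Deligne1972WeilK3] P. Deligne, La conjecture de Weil pour les surfaces K3, Invent. Math. 15 (1972), Prop. 7.5.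
* [VoisinHodgeII2003] C. Voisin, *Hodge Theory and Complex Algebraic Geometry II*, §3.2.2 Thm. 3.22, §6.2.1.
* [Dimca1992] A. Dimca, *Singularities and Topology of Hypersurfaces*, Ch. 4 §3 Prop. (3.1).
-/

noncomputable section

set_option linter.dupNamespace false

namespace Summit.HodgeConjecture.HodgeConjecture.Theorems.SignSymmetricPowersGeneralPencil

open CategoryTheory CategoryTheory.Limits
open Literature.AlgebraicGeometry.Motives Literature.AlgebraicGeometry.HodgeTheory
open Literature.AlgebraicGeometry.Motives.SmoothHypersurface (IsNonsingularForm)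

/-- **Reading (a″)-B, UNCONDITIONAL**: for every even `d ≥ 4`, on every pencil `f₀ + u·g` of ι-even quinary forms off the proper
algebraic set `Q(f₀, g) = 0` (non-empty complement witnessed), all but countably many members satisfy the Hodge conjecture on all
their self fibre powers. `signThreefoldPowersHodgeGeneralPencil_of_griffithsQP` (g15) applied to the cell's theorem
`griffiths1968_holomorphicHodgeSubbundlesQP_holds` (prover-Bx g18). NOT items 19716 ∕ 19715; HC not proved.
[cite: Griffiths1968PeriodsII, Thm. 1.1] [cite: VoisinHodgeI2002, §10.2.1 Thm. 10.3] [cite: Deligne1972WeilK3, Prop. 7.5]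
[cite: VoisinHodgeII2003, §3.2.2 Thm. 3.22 and §6.2.1] -/
theorem signThreefoldPowersHodgeGeneralPencil_holds :
    ∀ ⦃d : ℕ⦄, Even d → 4 ≤ d →
      ∃ Q : MvPolynomial ({e : Fin 5 →₀ ℕ // e.degree = d} ⊕ {e : Fin 5 →₀ ℕ // e.degree = d}) ℂ,
        (∃ f₀ g : MvPolynomial (Fin 5) ℂ, f₀.IsHomogeneous d ∧ g.IsHomogeneous d ∧
            (∀ e : Fin 5 →₀ ℕ, ¬ Even (e 0 + e 1) → f₀.coeff e = 0) ∧
            (∀ e : Fin 5 →₀ ℕ, ¬ Even (e 0 + e 1) → g.coeff e = 0) ∧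
            MvPolynomial.eval (Sum.elim (fun e : {e : Fin 5 →₀ ℕ // e.degree = d} => f₀.coeff e.1)
              (fun e : {e : Fin 5 →₀ ℕ // e.degree = d} => g.coeff e.1)) Q ≠ 0) ∧
        ∀ f₀ g : MvPolynomial (Fin 5) ℂ, f₀.IsHomogeneous d → g.IsHomogeneous d →
          (∀ e : Fin 5 →₀ ℕ, ¬ Even (e 0 + e 1) → f₀.coeff e = 0) →
          (∀ e : Fin 5 →₀ ℕ, ¬ Even (e 0 + e 1) → g.coeff e = 0) →
          MvPolynomial.eval (Sum.elim (fun e : {e : Fin 5 →₀ ℕ // e.degree = d} => f₀.coeff e.1)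
              (fun e : {e : Fin 5 →₀ ℕ // e.degree = d} => g.coeff e.1)) Q ≠ 0 →
          ∃ C : Set ℂ, C.Countable ∧ ∀ u : ℂ, u ∉ C →
            ∀ ⦃X : SchemeOver ℂ⦄, IsSmoothProjective 3 X →
              IsHypersurfaceCutOutBy 4 (f₀ + MvPolynomial.C u * g) X →
              ∀ ⦃k : ℕ⦄ ⦃Y : SchemeOver ℂ⦄, (∃ π : Fin (k + 1) → (Y ⟶ X), Nonempty (IsLimit (Fan.mk Y π))) →
                HodgeConjectureFor (3 * (k + 1)) Y :=
  signThreefoldPowersHodgeGeneralPencil_of_griffithsQP griffiths1968_holomorphicHodgeSubbundlesQP_holds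

/-- **Every smooth ι-even threefold lies on a good pencil, UNCONDITIONALLY**: for even `d ≥ 4` and every ι-even homogeneous
quinary `F₀` of degree `d` with `F₀ = 0` nonsingular there are an ι-even direction `G` and a countable `C ⊆ ℂ` such that for
`u ∉ C` every smooth projective `X ⊂ ℙ⁴` cut out by `F₀ + u·G` and every self fibre power `Y = X^{k+1}` satisfy
`HodgeConjectureFor (3(k+1)) Y`. `exists_goodPencil_through_of_griffithsQP` (g15, fixed-base Bertini) applied to
`griffiths1968_holomorphicHodgeSubbundlesQP_holds`. NOT items 19716 ∕ 19715; HC not proved.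
[cite: Dimca1992, Ch. 4 §3 Prop. (3.1)] [cite: Griffiths1968PeriodsII, Thm. 1.1] [cite: Deligne1972WeilK3, Prop. 7.5]
[cite: VoisinHodgeII2003, §3.2.2 Thm. 3.22 and §6.2.1] -/
theorem exists_goodPencil_through_holds {d : ℕ} (hd : Even d) (h4 : 4 ≤ d) {F₀ : MvPolynomial (Fin 5) ℂ}
    (hF₀ : F₀.IsHomogeneous d) (hevF : ∀ e : Fin 5 →₀ ℕ, ¬ Even (e 0 + e 1) → F₀.coeff e = 0) (hJ : IsNonsingularForm ℂ F₀) :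
    ∃ G : MvPolynomial (Fin 5) ℂ, G.IsHomogeneous d ∧ (∀ e : Fin 5 →₀ ℕ, ¬ Even (e 0 + e 1) → G.coeff e = 0) ∧
      ∃ C : Set ℂ, C.Countable ∧ ∀ u : ℂ, u ∉ C →
        ∀ ⦃X : SchemeOver ℂ⦄, IsSmoothProjective 3 X → IsHypersurfaceCutOutBy 4 (F₀ + MvPolynomial.C u * G) X →
          ∀ ⦃k : ℕ⦄ ⦃Y : SchemeOver ℂ⦄, (∃ π : Fin (k + 1) → (Y ⟶ X), Nonempty (IsLimit (Fan.mk Y π))) →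
            HodgeConjectureFor (3 * (k + 1)) Y :=
  exists_goodPencil_through_of_griffithsQP griffiths1968_holomorphicHodgeSubbundlesQP_holds hd h4 hF₀ hevF hJ

end Summit.HodgeConjecture.HodgeConjecture.Theorems.SignSymmetricPowersGeneralPencil

end
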